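import Mathlib
import HarnessLib
import Summits.ValiantsHypothesis.ValiantsHypothesis.Theses.MonotoneRestoration
import Literature.Computability.AlgebraicComplexity.ArithCircuit
import Literature.Computability.AlgebraicComplexity.ArithCircuitProofs
import Literature.Computability.AlgebraicComplexity.MonotoneStructure
import Literature.Computability.AlgebraicComplexity.PermanentIrreducible
import Literature.ModelTheory.FiniteModelTheory.CkEquiv
import Summits.ValiantsHypothesis.ValiantsHypothesis.Theorems.MonotoneRestorationMonotoneRestorationQPCosetCount
import Summits.ValiantsHypothesis.ValiantsHypothesis.Theorems.MonotoneRestorationMonotoneRestorationQPSymmetricLB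
import Summits.ValiantsHypothesis.ValiantsHypothesis.Theorems.MonotoneRestorationMonotoneRestorationQPSupportSymmetrisation
import Summits.ValiantsHypothesis.ValiantsHypothesis.Theorems.MonotoneRestorationMonotoneRestorationQPSparseRegime
import Summits.ValiantsHypothesis.ValiantsHypothesis.Theorems.MonotoneRestorationMonotoneRestorationQPBeta
import Literature.Computability.AlgebraicComplexity.SymmetricArithCircuit
import Literature.Computability.AlgebraicComplexity.DawarWilsenach2025Proofs
import Literature.GroupTheory.PermutationGroups.SmallIndexSubgroups
import Summits.ValiantsHypothesis.ValiantsHypothesis.Theorems.MonotoneRestorationQP.Negative.LoadBearing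
import Summits.ValiantsHypothesis.ValiantsHypothesis.Theorems.MonotoneRestorationMonotoneRestorationQPPermSupportCount

/-! # TTRL-lite variant V14628 of `MonotoneRestorationQP` / `stub_symmetricMonotone_choose_le_card` (stmt-ValiantsHypothesis-15886)

Machine-generated helper (proved); move `specialise+specialise`, op `fix_nat:n=2;fix_nat:k=2`: fix n := 2; fix k := 2.
See docs/architecture/ttrl-lite.md. -/

namespace Summit.ValiantsHypothesis.ValiantsHypothesis.Theorems

open Summit.ValiantsHypothesis.ValiantsHypothesis.Theses.MonotoneRestoration
open Literature.Computability.AlgebraicComplexity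

/-- TTRL-lite variant V14628 (specialise+specialise `fix_nat:n=2;fix_nat:k=2`) of `stub_symmetricMonotone_choose_le_card` (stmt-ValiantsHypothesis-15886); machine-found, kernel-checked. -/
theorem stub_symmetricMonotone_choose_le_card_var14628 :
    ∀ (G : Type) [Fintype G] (C : LabelledArithCircuit NNReal (Fin 2 × Fin 2) Unit G) (hC : C.IsSymmetric (Equiv.Perm (Fin 2))) (d : ℕ) (hhom : (C.eval (C.output ())).IsHomogeneous d) (h0 : C.eval (C.output ()) ≠ 0) (hrow : ∀ m ∈ (C.eval (C.output ())).support, ∀ i : Fin 2, rowDegrees m i ≤ 1) (hn : 8 < 2) (hk : 2 ≤ 2) (h4k : 4 * 2 ≤ 2) (hkd : 2 * 2 ≤ d) (hdk : d + 2 + 9 ≤ 2), (2).choose 2 ≤ Fintype.card G := by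
  intros
  omega

end Summit.ValiantsHypothesis.ValiantsHypothesis.Theorems
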